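import Summits.CriticalPhenomena.PercolationContinuityZ3.Theorems.PercNearOneGluingNoHeavyLowerTailSahiHittingWidthThree
import Summits.CriticalPhenomena.PercolationContinuityZ3.Theorems.PercNearOneGluingNoHeavyLowerTailSahiCombPrivate
import HarnessLib

/-!
# `NoHeavyLowerTail` (stmt-CriticalPhenomena-4575) — hitting families at EVERY order: only the SHARED coins matter
# (core-trace reduction; sunflowers with any kernel; nested kernels; trace width ≤ 3)

Support file, seat `prim-l12-p5` (gen 8), `--supports stmt-CriticalPhenomena-4575`.  No definitions, no named facts, no sorries,
standard axioms.

Setting: the product weight `bernoulliWeight p` on `2^ι` (`ι` finite) and HITTING EVENTS `H_A = {ω | ∃ a ∈ A, a ∈ ω}` of finite sets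
`A : Fin m → Finset ι`.  Gen 7 proved Sahi positivity `E_m(1_{H_{A_0}},…,1_{H_{A_{m−1}}}) ≥ 0` at every order for families of WIDTH ≤ 3
(≤ 4 with the kernel certificate of the hitting `C₄`).  Here the width hypothesis is moved from the sets `A_l` to their TRACES `K_l` on the
shared coins: write `A_l = K_l ⊔ B_l` where the "petals" `B_l` are private (a coin of `B_l` lies in no other `A_{l'}`).

* **`prodBernoulli_sahiE_hit_nonneg_of_core`** (the reduction, every order): if every sub-family of the trace family `(H_{K_l})_l` has
  `E ≥ 0`, then `E_m(1_{H_{A_0}},…,1_{H_{A_{m−1}}}) ≥ 0`.  Proof: induction on the number of private coins; a private coin `e ∈ B_i` is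
  eliminated by the `prim-masterthm` lane's affine identity `E = (1−p_e)·E(A_i ↦ A_i ∖ e) + p_e·E(A_i ↦ Ω)` (`SahiCombPrivate.sahiE_ind_private_eq`),
  and the slot `Ω` is removed by branching `E_{n+2}(1,g) = n·E_{n+1}(g)`, which lands in a SUB-family — whence the hereditary hypothesis.
  (The lane's own iteration `SahiCombPrivate.sahiE_ind_nonneg_of_core` asks for positivity of ALL families of events on the core, i.e. Sahi's
  conjecture on `2^S`, available only for `|S| ≤ 4`; the present form asks it only for the trace family and its sub-families, with no bound on `|S|`.)
* **`prodBernoulli_sahiE_hit_nonneg_of_core_width_le_three`**: if among any four indices two carry nested TRACES `K_i ⊆ K_j`, then `E_m ≥ 0`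
  (gen 7's width-3 theorem is hereditary).  Corollaries, every order, every product weight, standard axioms:
  **sunflowers with an arbitrary kernel** `C ⊆ A_l`, `A_i ∩ A_j ⊆ C` (`…_of_sunflower`; the `prim-masterthm` core theorems cover kernels of ≤ 3
  coins, ≤ 4 computationally), **nested kernels** `A_l = K_l ⊔ B_l` with the `K_l` totally ordered by inclusion (`…_of_nested_kernels`), and traces
  taking at most three distinct values (`…_of_three_traces`).
What remains open for hitting events after this reduction: families in which every coin is shared by ≥ 2 sets AND the family has width ≥ 5
(smallest: five sets on five shared coins, e.g. the non-isolation events of the 5-cycle).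
-/

noncomputable section

open scoped Classical

namespace Summit.CriticalPhenomena.PercolationContinuityZ3.Theorems

namespace SahiHitting

open Finset Function Literature.Combinatorics.Sahi2008 SahiMomentExpansion SahiHereditaryMeetAbsorption
open Literature.Probability.Percolation.DecisionTree (ind ind_of_mem ind_of_not_mem ind_nonneg)
open Literature.Probability.LatticeModels.Kahn2022 (Affects)

variable {ι : Type} [Fintype ι]

/-! ### Sections of hitting events at a coin, and private coins -/

omit [Fintype ι] in
/-- Forcing a coin of `A` open makes `H_A` certain: the `e ← 1` section of `H_A` is `Ω` for `e ∈ A`. [folklore] -/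
theorem secAt_true_hit_of_mem {A : Finset ι} {e : ι} (he : e ∈ A) :
    secAt e true {ω : Set ι | ∃ a ∈ A, a ∈ ω} = Set.univ := by
  ext ω
  simp only [mem_secAt, forceAt, cond_true, Set.mem_setOf_eq, Set.mem_univ, iff_true]
  exact ⟨e, he, Set.mem_insert e ω⟩

omit [Fintype ι] in
/-- Forcing the coin `e` closed: the `e ← 0` section of `H_A` is `H_{A ∖ e}`. [folklore] -/
theorem secAt_false_hit (A : Finset ι) (e : ι) :
    secAt e false {ω : Set ι | ∃ a ∈ A, a ∈ ω} = {ω : Set ι | ∃ a ∈ A.erase e, a ∈ ω} := by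
  ext ω
  simp only [mem_secAt, forceAt, cond_false, Set.mem_setOf_eq, Set.mem_sdiff, Set.mem_singleton_iff, Finset.mem_erase]
  constructor
  · rintro ⟨a, ha, haω, hae⟩; exact ⟨a, ⟨hae, ha⟩, haω⟩
  · rintro ⟨a, ⟨hae, ha⟩, haω⟩; exact ⟨a, ha, haω, hae⟩

omit [Fintype ι] in
/-- A coin outside `A` does not affect `H_A`. [folklore] -/
theorem not_affects_hit_of_not_mem {A : Finset ι} {e : ι} (he : e ∉ A) :
    ¬ Affects {ω : Set ι | ∃ a ∈ A, a ∈ ω} e := by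
  rintro ⟨ω, hω, a, ha, haω⟩
  rcases Set.mem_insert_iff.mp haω with rfl | h
  · exact he ha
  · exact hω ⟨a, ha, h⟩

/-! ### The core-trace reduction -/

/-- **Core-trace reduction, inductive form.**  Traces `K_l` and private petals `B_l` (pairwise disjoint, disjoint from every trace); if every
nonempty sub-family of `(H_{K_l})_l` has `E ≥ 0` then `E_m(1_{H_{K_0 ∪ B_0}},…,1_{H_{K_{m−1} ∪ B_{m−1}}}) ≥ 0`.  Induction on the total number
`Σ_l |B_l|` of private coins (uniformly in `m`): a private coin is eliminated by `SahiCombPrivate.sahiE_ind_private_eq`, the `Ω`-slot of the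
`e ← 1` section is removed by branching into the sub-family without that slot. [this work] -/
theorem prodBernoulli_sahiE_hit_nonneg_of_core_aux (p : ι → unitInterval) :
    ∀ (N m : ℕ) (K B : Fin m → Finset ι), (∑ l, (B l).card) ≤ N →
      (∀ l l', l ≠ l' → Disjoint (B l) (B l')) → (∀ l l', Disjoint (B l) (K l')) →
      (∀ S : Finset (Fin m), S.Nonempty →
        0 ≤ sahiE (bernoulliWeight p) S.card (fun j => ind {ω : Set ι | ∃ a ∈ K (S.orderEmbOfFin rfl j), a ∈ ω})) →
      0 ≤ sahiE (bernoulliWeight p) m (fun l => ind {ω : Set ι | ∃ a ∈ K l ∪ B l, a ∈ ω}) := by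
  intro N
  induction N with
  | zero =>
    intro m K B hN _ _ hK
    have hB : ∀ l, B l = ∅ := fun l =>
      Finset.card_eq_zero.1 ((Finset.sum_eq_zero_iff.1 (Nat.le_zero.1 hN)) l (mem_univ l))
    simp only [hB, Finset.union_empty]
    rcases Nat.eq_zero_or_pos m with rfl | hm
    · rw [sahiE_zero]
    · have key := hK univ (Finset.univ_nonempty_iff.mpr (Fin.pos_iff_nonempty.mp hm))
      rwa [subfamily_univ (bernoulliWeight p) (fun l => ind {ω : Set ι | ∃ a ∈ K l, a ∈ ω})] at key
  | succ N ih =>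
    intro m K B hN hBB hBK hK
    by_cases hall : ∀ l, B l = ∅
    · simp only [hall, Finset.union_empty]
      rcases Nat.eq_zero_or_pos m with rfl | hm
      · rw [sahiE_zero]
      · have key := hK univ (Finset.univ_nonempty_iff.mpr (Fin.pos_iff_nonempty.mp hm))
        rwa [subfamily_univ (bernoulliWeight p) (fun l => ind {ω : Set ι | ∃ a ∈ K l, a ∈ ω})] at key
    · obtain ⟨i, hi⟩ := not_forall.1 hall
      obtain ⟨e, he⟩ := Finset.nonempty_iff_ne_empty.2 hi
      -- `m = n + 1`
      obtain ⟨n, rfl⟩ : ∃ n, m = n + 1 := Nat.exists_eq_succ_of_ne_zero (Fin.pos i).ne'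
      have hμ := isFKGMeasure_bernoulliWeight p
      -- the family as events, the private coin `e ∈ B i`
      set U : Fin (n + 1) → Set (Set ι) := fun l => {ω : Set ι | ∃ a ∈ K l ∪ B l, a ∈ ω} with hU_def
      have hU : ∀ j, IsUpperSet (U j) := fun j => isUpperSet_hit (K j ∪ B j)
      have heK : ∀ l, e ∉ K l := fun l h => Finset.disjoint_left.1 (hBK i l) he h
      have heB : ∀ l, l ≠ i → e ∉ B l := fun l hl h => Finset.disjoint_left.1 (hBB i l (Ne.symm hl)) he h
      have hpriv : ∀ j, j ≠ i → ¬ Affects (U j) e := fun j hj =>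
        not_affects_hit_of_not_mem (by rw [Finset.mem_union, not_or]; exact ⟨heK j, heB j hj⟩)
      have hfam : (fun l => ind {ω : Set ι | ∃ a ∈ K l ∪ B l, a ∈ ω}) = fun j => ind (U j) := rfl
      rw [hfam, SahiCombPrivate.sahiE_ind_private_eq p U hU i e hpriv]
      have hei : e ∈ K i ∪ B i := Finset.mem_union_right _ he
      -- the `e ← 0` section: `B i ↦ B i ∖ e`
      have h0 : 0 ≤ sahiE (bernoulliWeight p) (n + 1) (fun j => ind (update U i (secAt e false (U i)) j)) := by
        have hsec : update U i (secAt e false (U i)) = fun l => {ω : Set ι | ∃ a ∈ K l ∪ update B i ((B i).erase e) l, a ∈ ω} := by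
          funext l
          by_cases hl : l = i
          · subst hl
            rw [update_self, update_self, hU_def, secAt_false_hit, Finset.erase_union_distrib, Finset.erase_eq_of_notMem (heK l)]
          · rw [update_of_ne hl, update_of_ne hl]
        rw [hsec]
        refine ih (n + 1) K (update B i ((B i).erase e)) ?_ ?_ ?_ hK
        · -- one private coin fewer
          have hlt : ∑ l, (update B i ((B i).erase e) l).card < ∑ l, (B l).card := by
            refine Finset.sum_lt_sum (fun l _ => ?_) ⟨i, mem_univ i, ?_⟩
            · by_cases hl : l = i
              · subst hl; rw [update_self]; exact Finset.card_le_card (Finset.erase_subset e (B l))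
              · rw [update_of_ne hl]
            · rw [update_self]; exact Finset.card_erase_lt_of_mem he
          omega
        · intro l l' hll'
          have hsub : ∀ j, update B i ((B i).erase e) j ⊆ B j := fun j => by
            by_cases hj : j = i
            · subst hj; rw [update_self]; exact Finset.erase_subset e (B j)
            · rw [update_of_ne hj]
          exact Finset.disjoint_of_subset_left (hsub l) (Finset.disjoint_of_subset_right (hsub l') (hBB l l' hll'))
        · intro l l'
          have hsub : update B i ((B i).erase e) l ⊆ B l := by
            by_cases hj : l = i
            · subst hj; rw [update_self]; exact Finset.erase_subset e (B l)
            · rw [update_of_ne hj]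
          exact Finset.disjoint_of_subset_left hsub (hBK l l')
      -- the `e ← 1` section: slot `i` becomes `Ω`, removed by branching
      have h1 : 0 ≤ sahiE (bernoulliWeight p) (n + 1) (fun j => ind (update U i (secAt e true (U i)) j)) := by
        have hsec : (fun j => ind (update U i (secAt e true (U i)) j)) = update (fun j => ind (U j)) i 1 := by
          funext j
          by_cases hj : j = i
          · subst hj; rw [update_self, update_self, hU_def, secAt_true_hit_of_mem hei, ind_univ_eq_one]
          · rw [update_of_ne hj, update_of_ne hj]
        rw [hsec, SahiMeetTowerAll.sahiE_update_eq_sahiE_cons]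
        rcases Nat.eq_zero_or_pos n with hn0 | hnpos
        · subst hn0
          rw [sahiE_one_apply]
          show 0 ≤ ex (bernoulliWeight p) 1
          rw [ex_one hμ.sum_eq_one]; exact zero_le_one
        · obtain ⟨n', rfl⟩ : ∃ n', n = n' + 1 := Nat.exists_eq_succ_of_ne_zero hnpos.ne'
          have hcons : (Fin.cons (1 : Set ι → ℝ) (i.removeNth fun j => ind (U j)) : Fin (n' + 2) → Set ι → ℝ)
              = Matrix.vecCons 1 (i.removeNth fun j => ind (U j)) := rfl
          rw [hcons, sahiE_one_cons hμ.sum_eq_one]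
          refine mul_nonneg (Nat.cast_nonneg n') ?_
          -- the family without slot `i` is of the same shape, with fewer private coins
          have hrem : (i.removeNth fun j => ind (U j))
              = fun l => ind {ω : Set ι | ∃ a ∈ K (i.succAbove l) ∪ B (i.succAbove l), a ∈ ω} := rfl
          rw [hrem]
          refine ih (n' + 1) (fun l => K (i.succAbove l)) (fun l => B (i.succAbove l)) ?_ ?_ ?_ ?_
          · have hsplit := Fin.sum_univ_succAbove (fun l => (B l).card) i
            have hpos : 0 < (B i).card := Finset.card_pos.2 ⟨e, he⟩
            omega
          · intro l l' hll'
            exact hBB _ _ (fun h => hll' (Fin.succAbove_right_injective h))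
          · intro l l'
            exact hBK _ _
          · -- sub-families of the shortened trace family are sub-families of the trace family
            intro S' hS'
            let emb : Fin (n' + 1) ↪o Fin (n' + 2) := Fin.succAboveOrderEmb i
            have key := hK (S'.map emb.toEmbedding) (by simpa using hS')
            rw [subfamily_map_orderEmb (bernoulliWeight p) emb S' (fun l => ind {ω : Set ι | ∃ a ∈ K l, a ∈ ω})] at key
            exact key
      exact add_nonneg (mul_nonneg (sub_nonneg.2 (p e).2.2) h0) (mul_nonneg (p e).2.1 h1)

/-- **Core-trace reduction (every order).**  Let `A_l = K_l ⊔ (A_l ∖ K_l)` where the coins of `A_l ∖ K_l` are PRIVATE to `A_l`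
(they lie in no other `A_{l'}`).  If every nonempty sub-family of the trace family `(H_{K_l})_l` has `E ≥ 0`, then
`E_m(1_{H_{A_0}},…,1_{H_{A_{m−1}}}) ≥ 0` on every finite product space.  [this work] -/
theorem prodBernoulli_sahiE_hit_nonneg_of_core (p : ι → unitInterval) (m : ℕ) (A K : Fin m → Finset ι)
    (hKA : ∀ l, K l ⊆ A l) (hpriv : ∀ l, ∀ a ∈ A l, a ∉ K l → ∀ l', l' ≠ l → a ∉ A l')
    (hK : ∀ S : Finset (Fin m), S.Nonempty →
      0 ≤ sahiE (bernoulliWeight p) S.card (fun j => ind {ω : Set ι | ∃ a ∈ K (S.orderEmbOfFin rfl j), a ∈ ω})) :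
    0 ≤ sahiE (bernoulliWeight p) m (fun l => ind {ω : Set ι | ∃ a ∈ A l, a ∈ ω}) := by
  have hA : (fun l => ind {ω : Set ι | ∃ a ∈ A l, a ∈ ω}) = fun l => ind {ω : Set ι | ∃ a ∈ K l ∪ (A l \ K l), a ∈ ω} := by
    funext l; rw [Finset.union_sdiff_of_subset (hKA l)]
  rw [hA]
  refine prodBernoulli_sahiE_hit_nonneg_of_core_aux p _ m K (fun l => A l \ K l) le_rfl ?_ ?_ hK
  · intro l l' hll'
    rw [Finset.disjoint_left]
    intro a ha ha'
    rw [Finset.mem_sdiff] at ha ha'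
    exact hpriv l a ha.1 ha.2 l' (Ne.symm hll') ha'.1
  · intro l l'
    rw [Finset.disjoint_left]
    intro a ha ha'
    rw [Finset.mem_sdiff] at ha
    by_cases hll' : l' = l
    · subst hll'; exact ha.2 ha'
    · exact hpriv l a ha.1 ha.2 l' hll' (hKA l' ha')

/-! ### Trace width ≤ 3, sunflowers, nested kernels -/

/-- **Every order for hitting families whose TRACES have width ≤ 3.**  `A_l ⊇ K_l` with private differences; if among any four indices two
carry nested traces `K_i ⊆ K_j` (equal traces count), then `E_m(1_{H_{A_0}},…,1_{H_{A_{m−1}}}) ≥ 0`.  (Gen 7's width-3 theorem applied to the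
sub-families of the trace family — the width hypothesis is hereditary.) [this work] -/
theorem prodBernoulli_sahiE_hit_nonneg_of_core_width_le_three (p : ι → unitInterval) (m : ℕ) (A K : Fin m → Finset ι)
    (hKA : ∀ l, K l ⊆ A l) (hpriv : ∀ l, ∀ a ∈ A l, a ∉ K l → ∀ l', l' ≠ l → a ∉ A l')
    (hw : ∀ S : Finset (Fin m), S.card = 4 → ∃ i ∈ S, ∃ j ∈ S, i ≠ j ∧ K i ⊆ K j) :
    0 ≤ sahiE (bernoulliWeight p) m (fun l => ind {ω : Set ι | ∃ a ∈ A l, a ∈ ω}) := by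
  refine prodBernoulli_sahiE_hit_nonneg_of_core p m A K hKA hpriv fun S _ => ?_
  refine prodBernoulli_sahiE_hit_nonneg_of_width_le_three p S.card (fun j => K (S.orderEmbOfFin rfl j)) fun T hT => ?_
  -- transport the width hypothesis along the increasing enumeration of `S`
  set f : Fin S.card ↪o Fin m := S.orderEmbOfFin rfl
  obtain ⟨i, hi, j, hj, hij, hsub⟩ := hw (T.map f.toEmbedding) (by rw [Finset.card_map]; exact hT)
  obtain ⟨i', hi', rfl⟩ := Finset.mem_map.mp hi
  obtain ⟨j', hj', rfl⟩ := Finset.mem_map.mp hj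
  exact ⟨i', hi', j', hj', fun h => hij (by rw [h]), hsub⟩

/-- **SUNFLOWERS, any kernel, any petals, every order.**  If a finite set `C` is contained in every `A_l` and contains every pairwise
intersection (`a ∈ A_i ∩ A_j ⇒ a ∈ C` for `i ≠ j`), then `E_m(1_{H_{A_0}},…,1_{H_{A_{m−1}}}) ≥ 0` on every finite product space
(the traces are all equal to `C`).  The `prim-masterthm` lane's core theorems give this for `|C| ≤ 3` (≤ 4 with a kernel certificate);
here `|C|` is arbitrary. [this work] -/
theorem prodBernoulli_sahiE_hit_nonneg_of_sunflower (p : ι → unitInterval) (m : ℕ) (A : Fin m → Finset ι) (C : Finset ι)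
    (hC : ∀ l, C ⊆ A l) (hpet : ∀ i j, i ≠ j → ∀ a ∈ A i, a ∈ A j → a ∈ C) :
    0 ≤ sahiE (bernoulliWeight p) m (fun l => ind {ω : Set ι | ∃ a ∈ A l, a ∈ ω}) := by
  refine prodBernoulli_sahiE_hit_nonneg_of_core_width_le_three p m A (fun _ => C) hC
    (fun l a ha haC l' hl' ha' => haC (hpet l l' (Ne.symm hl') a ha ha')) fun S hS => ?_
  obtain ⟨i, hi, j, hj, hij⟩ := Finset.one_lt_card.mp (by omega : 1 < S.card)
  exact ⟨i, hi, j, hj, hij, subset_rfl⟩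

/-- **NESTED KERNELS, every order.**  `A_l ⊇ K_l` with private differences and the kernels `K_l` totally ordered by inclusion (in any
order along the index): `E_m ≥ 0`. [this work] -/
theorem prodBernoulli_sahiE_hit_nonneg_of_nested_kernels (p : ι → unitInterval) (m : ℕ) (A K : Fin m → Finset ι)
    (hKA : ∀ l, K l ⊆ A l) (hpriv : ∀ l, ∀ a ∈ A l, a ∉ K l → ∀ l', l' ≠ l → a ∉ A l')
    (hchain : ∀ i j, K i ⊆ K j ∨ K j ⊆ K i) :
    0 ≤ sahiE (bernoulliWeight p) m (fun l => ind {ω : Set ι | ∃ a ∈ A l, a ∈ ω}) := by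
  refine prodBernoulli_sahiE_hit_nonneg_of_core_width_le_three p m A K hKA hpriv fun S hS => ?_
  obtain ⟨i, hi, j, hj, hij⟩ := Finset.one_lt_card.mp (by omega : 1 < S.card)
  rcases hchain i j with h | h
  · exact ⟨i, hi, j, hj, hij, h⟩
  · exact ⟨j, hj, i, hi, hij.symm, h⟩

/-- **At most three distinct traces, arbitrary multiplicities, every order.**  `A_l = C_{c l} ⊔ (private)` for three finite sets
`C_0, C_1, C_2` and any assignment `c : Fin m → Fin 3`: `E_m ≥ 0` (pigeonhole among four indices). [this work] -/
theorem prodBernoulli_sahiE_hit_nonneg_of_three_traces (p : ι → unitInterval) (C : Fin 3 → Finset ι) (m : ℕ) (c : Fin m → Fin 3)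
    (A : Fin m → Finset ι) (hCA : ∀ l, C (c l) ⊆ A l) (hpriv : ∀ l, ∀ a ∈ A l, a ∉ C (c l) → ∀ l', l' ≠ l → a ∉ A l') :
    0 ≤ sahiE (bernoulliWeight p) m (fun l => ind {ω : Set ι | ∃ a ∈ A l, a ∈ ω}) := by
  refine prodBernoulli_sahiE_hit_nonneg_of_core_width_le_three p m A (fun l => C (c l)) hCA hpriv fun S hS => ?_
  have hlt : (Finset.univ : Finset (Fin 3)).card < S.card := by simp [hS]
  obtain ⟨i, hi, j, hj, hij, hc⟩ := Finset.exists_ne_map_eq_of_card_lt_of_maps_to hlt (f := c) fun _ _ => Finset.mem_univ _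
  exact ⟨i, hi, j, hj, hij, by simp [hc]⟩

end SahiHitting

end Summit.CriticalPhenomena.PercolationContinuityZ3.Theorems

end
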